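import Summits.CriticalPhenomena.PercolationContinuityZ3.Theorems.PercNearOneGluingNoHeavyLowerTailNetworkFoldGlue
import Summits.CriticalPhenomena.PercolationContinuityZ3.Theorems.PercNearOneGluingNoHeavyLowerTailApexTwoSumSums
import HarnessLib

/-!
# `NoHeavyLowerTail` (stmt-CriticalPhenomena-4575) — FOLDING A TERMINAL-FREE TWO-TERMINAL NETWORK, part 2 (measure level, every `q > 0`):
# the three-point cells of `φ_{𝐩,q}` do not change when the network is replaced by one edge of the effective parameter

Support file (prover prim-gen-kcluster gen 72; `--supports stmt-CriticalPhenomena-4575`).  No definitions, no named facts, no sorries.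

SE({u, v} : Set V)ING (part 1 `…NetworkFoldGlue`).  Supports `DX` (the NETWORK, poles `u ≠ v`, joined inside it: `v ∈ cl DX u`) and `DY` (the REST) on a
finite vertex type, meeting only in `{u, v}`; `a, b, c` lie on pairs of `DX` only as poles; `w` vanishes off `DX ∪ DY`, `wX = w·1_{DX}`,
`wY = w·1_{DXᶜ}`; `T = {u, v}`, `K = q^{k^T(∅)}`, `J = {v ∈ C(u)}`.  WIRED NETWORK MASSES `X₁ = Σ_η rcW^T_{wX}(η) 1_J(η)`, `X₀ = Σ_η rcW^T_{wX}(η) 1_{¬J}(η)`.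
* `NetworkFold.pt`, `NetworkFold.sum_eq` (THE DICTIONARY): for every pair of events `E_G` (glued graph), `E` (reference: the rest plus the single
  pair `uv`) satisfying the replacement property of part 1 (`ω ∈ E_G ↔ insert uv (ω ∖ DX) ∈ E` when `J(ω ∩ DX)`, `↔ ω ∖ DX ∈ E` otherwise):
  `K · Zφ(E_G) = X₁ · A(E) + X₀ · B(E)` with `A(E) = Σ_η rcW^T_{wY}(η) 1_E(η + uv)`, `B(E) = Σ_η rcW^T_{wY}(η) 1_E(η) q^{[v ∉ C_η(u)]}`.
* `NetworkFold.real_eq_of_replace` (FOLDING IDENTITY): two networks `DX`, `DX'` glued to the same rest with PROPORTIONAL wired masses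
  (`X₁ X₀' = X₀ X₁'`) give the same probability to corresponding events; `real_T_eq / real_Ub_eq / real_Uc_eq / real_S_eq`, `r1_iff` for the cells
  `T, U_b, U_c, S` of `(a; b, c)` (part 1 supplies the replacement property).
* SINGLE EDGE (`X₁' = p' K`, `X₀' = (1 − p') K`, `single_X1 / single_X0`): `r1_iff_single` — with `p' (X₀ + X₁) = X₁` on the pair `uv` and the
  rest unchanged, R1 for `(a; b, c)` holds for `φ_{𝐩,q}` on `DX ∪ DY` iff it holds for `φ_{𝐩',q}` on `{uv} ∪ DY`; `exists_single_weight` — such a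
  `𝐩'` exists.  This is the Fortuin–Kasteleyn series/parallel reduction in general form (any terminal-free two-terminal subnetwork, any `q > 0`);
  with the cut-vertex theorems (`…OneSumFree`, `…OneSumApexBlock`, `…ApexTwoSumPendant`) a minimal counterexample to R1-RC(q) is 2-connected
  and every `{u,v}`-bridge avoiding `a, b, c` is a single edge.
-/

noncomputable section

namespace Summit.CriticalPhenomena.PercolationContinuityZ3.Theorems

namespace NetworkFold

open Finset SimpleGraph Literature.Probability.Percolation Literature.Probability.Percolation.Gladkov
open Literature.Probability.Percolation.BHK2006 (weight)
open Literature.Probability.Percolation.DecisionTree (ind ind_of_mem ind_of_not_mem ind_nonneg)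
open Literature.Probability.LatticeModels RefinedRowR3 ThreePointLB MeasureTheory
open scoped Classical

variable {V : Type*} [Fintype V]

/-! ### The dictionary -/

section Pointwise

variable {DX DY : Finset (Sym2 V)} {u v : V} (huv : u ≠ v)
  (hsepD : ∀ z : V, (∃ e ∈ DX, z ∈ e) → (∃ e ∈ DY, z ∈ e) → (z = u ∨ z = v))
  (w : Sym2 V → unitInterval) (q : ℝ) (hw : ∀ e, e ∉ (↑DX ∪ ↑DY : Set (Sym2 V)) → (w e : ℝ) = 0)
include huv hsepD hw

/-- **Pointwise dictionary**: for events with the replacement property, `K · rcW(ω) 1_{E_G}(ω)` splits along `J(ω ∩ DX)`. [this work] -/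
theorem pt {EG E : Set (BondConfig V)} (hEJ : (∀ ω : BondConfig V, ω ⊆ ↑DX ∪ ↑DY → (ω ∩ ↑DX) ∈ {η : BondConfig V | v ∈ cl η.toFinset u} → (ω ∈ EG ↔ insert s(u, v) (ω \ ↑DX) ∈ E))) (hEn : (∀ ω : BondConfig V, ω ⊆ ↑DX ∪ ↑DY → (ω ∩ ↑DX) ∉ {η : BondConfig V | v ∈ cl η.toFinset u} → (ω ∈ EG ↔ (ω \ ↑DX) ∈ E))) (ω : BondConfig V) :
    rcWeightW w q ∅ ω * ind EG ω * q ^ clusterCount (∅ : BondConfig V) ({u, v} : Set V) =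
      weight (fun e => (w e : ℝ)) ω *
          ((ind {η : BondConfig V | v ∈ cl η.toFinset u} (ω ∩ ↑DX) * q ^ clusterCount (ω ∩ ↑DX) ({u, v} : Set V)) *
            (ind {η : BondConfig V | insert s(u, v) η ∈ E} (ω \ ↑DX) * q ^ clusterCount (ω \ ↑DX) ({u, v} : Set V))) +
        weight (fun e => (w e : ℝ)) ω *
          ((ind {η : BondConfig V | v ∉ cl η.toFinset u} (ω ∩ ↑DX) * q ^ clusterCount (ω ∩ ↑DX) ({u, v} : Set V)) *
            ((ind E (ω \ ↑DX) * (if (ω \ ↑DX) ∈ {η : BondConfig V | v ∈ cl η.toFinset u} then 1 else q)) * q ^ clusterCount (ω \ ↑DX) ({u, v} : Set V))) := by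
  by_cases hω : ω ⊆ ↑DX ∪ ↑DY
  swap
  · obtain ⟨e, heω, heD⟩ := Set.not_subset.1 hω
    have h0 := ApexTwoSum.weight_eq_zero_of_mem_not_mem w hw heω heD
    unfold rcWeightW
    rw [h0]; ring
  have hadd := ApexTwoSum.kT_add hsepD hω
  have hglue := ApexTwoSum.glued_h_iff hsepD hω
  by_cases hJ : (ω ∩ ↑DX) ∈ {η : BondConfig V | v ∈ cl η.toFinset u}
  · have hvu : v ∈ cl ω.toFinset u := hglue.2 (Or.inl hJ)
    have hk := ApexTwoSum.k_of_mem huv ω hvu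
    have hpow : q ^ clusterCount ω ∅ * q ^ clusterCount (∅ : BondConfig V) ({u, v} : Set V) = q ^ clusterCount (ω ∩ ↑DX) ({u, v} : Set V) * q ^ clusterCount (ω \ ↑DX) ({u, v} : Set V) := by
      rw [← pow_add, hk, hadd, pow_add]
    have hnJ : (ω ∩ ↑DX) ∉ {η : BondConfig V | v ∉ cl η.toFinset u} := fun h => h hJ
    rw [ind_of_mem hJ, ind_of_not_mem hnJ]
    by_cases hE : insert s(u, v) (ω \ ↑DX) ∈ E
    · have h1 : (ω \ ↑DX) ∈ {η : BondConfig V | insert s(u, v) η ∈ E} := hE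
      rw [ind_of_mem h1, ind_of_mem ((hEJ ω hω hJ).2 hE)]
      unfold rcWeightW
      linear_combination (weight (fun e => (w e : ℝ)) ω) * hpow
    · have h1 : (ω \ ↑DX) ∉ {η : BondConfig V | insert s(u, v) η ∈ E} := hE
      rw [ind_of_not_mem h1, ind_of_not_mem (fun h => hE ((hEJ ω hω hJ).1 h))]
      ring
  · have hJ' : (ω ∩ ↑DX) ∈ {η : BondConfig V | v ∉ cl η.toFinset u} := hJ
    rw [ind_of_not_mem hJ, ind_of_mem hJ']
    by_cases hJY : (ω \ ↑DX) ∈ {η : BondConfig V | v ∈ cl η.toFinset u}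
    · have hvu : v ∈ cl ω.toFinset u := hglue.2 (Or.inr hJY)
      have hk := ApexTwoSum.k_of_mem huv ω hvu
      have hpow : q ^ clusterCount ω ∅ * q ^ clusterCount (∅ : BondConfig V) ({u, v} : Set V) = q ^ clusterCount (ω ∩ ↑DX) ({u, v} : Set V) * q ^ clusterCount (ω \ ↑DX) ({u, v} : Set V) := by
        rw [← pow_add, hk, hadd, pow_add]
      rw [if_pos hJY]
      by_cases hE : (ω \ ↑DX) ∈ E
      · rw [ind_of_mem hE, ind_of_mem ((hEn ω hω hJ).2 hE)]
        unfold rcWeightW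
        linear_combination (weight (fun e => (w e : ℝ)) ω) * hpow
      · rw [ind_of_not_mem hE, ind_of_not_mem (fun h => hE ((hEn ω hω hJ).1 h))]
        ring
    · have hvu : v ∉ cl ω.toFinset u := fun h => (hglue.1 h).elim hJ hJY
      have hk := ApexTwoSum.k_of_not_mem huv ω hvu
      have hpow : q ^ clusterCount ω ∅ * q ^ clusterCount (∅ : BondConfig V) ({u, v} : Set V) = q ^ clusterCount (ω ∩ ↑DX) ({u, v} : Set V) * q ^ clusterCount (ω \ ↑DX) ({u, v} : Set V) * q := by
        rw [hk, pow_succ, mul_right_comm, ← pow_add, hadd, pow_add]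
      rw [if_neg hJY]
      by_cases hE : (ω \ ↑DX) ∈ E
      · rw [ind_of_mem hE, ind_of_mem ((hEn ω hω hJ).2 hE)]
        unfold rcWeightW
        linear_combination (weight (fun e => (w e : ℝ)) ω) * hpow
      · rw [ind_of_not_mem hE, ind_of_not_mem (fun h => hE ((hEn ω hω hJ).1 h))]
        ring

end Pointwise

section Sums

variable {DX DY : Finset (Sym2 V)} {u v : V} (huv : u ≠ v)
  (hsepD : ∀ z : V, (∃ e ∈ DX, z ∈ e) → (∃ e ∈ DY, z ∈ e) → (z = u ∨ z = v))
  (w wX wY : Sym2 V → unitInterval) {q : ℝ} (hw : ∀ e, e ∉ (↑DX ∪ ↑DY : Set (Sym2 V)) → (w e : ℝ) = 0)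
  (hX : ∀ e ∈ (↑DX : Set (Sym2 V)), wX e = w e) (hX' : ∀ e ∉ (↑DX : Set (Sym2 V)), wX e = 0)
  (hY : ∀ e ∈ (↑DX : Set (Sym2 V)), wY e = 0) (hY' : ∀ e ∉ (↑DX : Set (Sym2 V)), wY e = w e)
include huv hsepD hw hX hX' hY hY'

/-- **The dictionary**: `K · Zφ(E_G) = X₁ · A(E) + X₀ · B(E)` for events with the replacement property. [this work] -/
theorem sum_eq {EG E : Set (BondConfig V)} (hEJ : (∀ ω : BondConfig V, ω ⊆ ↑DX ∪ ↑DY → (ω ∩ ↑DX) ∈ {η : BondConfig V | v ∈ cl η.toFinset u} → (ω ∈ EG ↔ insert s(u, v) (ω \ ↑DX) ∈ E))) (hEn : (∀ ω : BondConfig V, ω ⊆ ↑DX ∪ ↑DY → (ω ∩ ↑DX) ∉ {η : BondConfig V | v ∈ cl η.toFinset u} → (ω ∈ EG ↔ (ω \ ↑DX) ∈ E))) :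
    (∑ ω : BondConfig V, rcWeightW w q ∅ ω * ind EG ω) * q ^ clusterCount (∅ : BondConfig V) ({u, v} : Set V) = (∑ η : BondConfig V, rcWeightW wX q ({u, v} : Set V) η * ind {η : BondConfig V | v ∈ cl η.toFinset u} η) * (∑ η : BondConfig V, rcWeightW wY q ({u, v} : Set V) η * ind {η : BondConfig V | insert s(u, v) η ∈ E} η) + (∑ η : BondConfig V, rcWeightW wX q ({u, v} : Set V) η * ind {η : BondConfig V | v ∉ cl η.toFinset u} η) * (∑ η : BondConfig V, rcWeightW wY q ({u, v} : Set V) η * (ind E η * (if η ∈ {η : BondConfig V | v ∈ cl η.toFinset u} then 1 else q))) := by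
  rw [Finset.sum_mul, Finset.sum_congr rfl fun ω _ => pt huv hsepD w q hw hEJ hEn ω, Finset.sum_add_distrib]
  have e1 := ApexTwoSum.sum_weight_blocks_rc w wX wY (↑DX) hX hX' hY hY' q ({u, v} : Set V)
    (fun x => ind {η : BondConfig V | v ∈ cl η.toFinset u} x) (fun y => ind {η : BondConfig V | insert s(u, v) η ∈ E} y)
  have e2 := ApexTwoSum.sum_weight_blocks_rc w wX wY (↑DX) hX hX' hY hY' q ({u, v} : Set V)
    (fun x => ind {η : BondConfig V | v ∉ cl η.toFinset u} x) (fun y => ind E y * (if y ∈ {η : BondConfig V | v ∈ cl η.toFinset u} then 1 else q))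
  beta_reduce at e1 e2
  rw [← e1, ← e2]

end Sums

/-! ### The folding identity -/

section Main

variable {DX DX' DY : Finset (Sym2 V)} {u v a b c : V} (huv : u ≠ v)
  (hsepD : ∀ z : V, (∃ e ∈ DX, z ∈ e) → (∃ e ∈ DY, z ∈ e) → (z = u ∨ z = v))
  (hsepD' : ∀ z : V, (∃ e ∈ DX', z ∈ e) → (∃ e ∈ DY, z ∈ e) → (z = u ∨ z = v))
  (ha : ∀ e ∈ DX, a ∈ e → (a = u ∨ a = v)) (ha' : ∀ e ∈ DX', a ∈ e → (a = u ∨ a = v))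
  (hb : ∀ e ∈ DX, b ∈ e → (b = u ∨ b = v)) (hb' : ∀ e ∈ DX', b ∈ e → (b = u ∨ b = v))
  (hc : ∀ e ∈ DX, c ∈ e → (c = u ∨ c = v)) (hc' : ∀ e ∈ DX', c ∈ e → (c = u ∨ c = v))
  (hN : v ∈ cl DX u) (hN' : v ∈ cl DX' u)
  (w w' wX wX' wY : Sym2 V → unitInterval) {q : ℝ} (hq : 0 < q)
  (hw : ∀ e, e ∉ (↑DX ∪ ↑DY : Set (Sym2 V)) → (w e : ℝ) = 0)
  (hw' : ∀ e, e ∉ (↑DX' ∪ ↑DY : Set (Sym2 V)) → (w' e : ℝ) = 0)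
  (hX : ∀ e ∈ (↑DX : Set (Sym2 V)), wX e = w e) (hX' : ∀ e ∉ (↑DX : Set (Sym2 V)), wX e = 0)
  (hY : ∀ e ∈ (↑DX : Set (Sym2 V)), wY e = 0) (hY' : ∀ e ∉ (↑DX : Set (Sym2 V)), wY e = w e)
  (gX : ∀ e ∈ (↑DX' : Set (Sym2 V)), wX' e = w' e) (gX' : ∀ e ∉ (↑DX' : Set (Sym2 V)), wX' e = 0)
  (gY : ∀ e ∈ (↑DX' : Set (Sym2 V)), wY e = 0) (gY' : ∀ e ∉ (↑DX' : Set (Sym2 V)), wY e = w' e)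
  (hodds : (∑ η : BondConfig V, rcWeightW wX q ({u, v} : Set V) η * ind {η : BondConfig V | v ∈ cl η.toFinset u} η) * (∑ η : BondConfig V, rcWeightW wX' q ({u, v} : Set V) η * ind {η : BondConfig V | v ∉ cl η.toFinset u} η) = (∑ η : BondConfig V, rcWeightW wX q ({u, v} : Set V) η * ind {η : BondConfig V | v ∉ cl η.toFinset u} η) * (∑ η : BondConfig V, rcWeightW wX' q ({u, v} : Set V) η * ind {η : BondConfig V | v ∈ cl η.toFinset u} η))
include huv hsepD hsepD' hq hw hw' hX hX' hY hY' gX gX' gY gY' hodds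

/-- **Folding identity**: two networks glued to the same rest, with proportional wired masses (`X₁ X₀' = X₀ X₁'`), give the same
probability to events with the replacement property towards a common reference event. [this work] -/
theorem real_eq_of_replace {EG EG' E : Set (BondConfig V)}
    (hEJ : (∀ ω : BondConfig V, ω ⊆ ↑DX ∪ ↑DY → (ω ∩ ↑DX) ∈ {η : BondConfig V | v ∈ cl η.toFinset u} → (ω ∈ EG ↔ insert s(u, v) (ω \ ↑DX) ∈ E))) (hEn : (∀ ω : BondConfig V, ω ⊆ ↑DX ∪ ↑DY → (ω ∩ ↑DX) ∉ {η : BondConfig V | v ∈ cl η.toFinset u} → (ω ∈ EG ↔ (ω \ ↑DX) ∈ E))) (gEJ : (∀ ω : BondConfig V, ω ⊆ ↑DX' ∪ ↑DY → (ω ∩ ↑DX') ∈ {η : BondConfig V | v ∈ cl η.toFinset u} → (ω ∈ EG' ↔ insert s(u, v) (ω \ ↑DX') ∈ E))) (gEn : (∀ ω : BondConfig V, ω ⊆ ↑DX' ∪ ↑DY → (ω ∩ ↑DX') ∉ {η : BondConfig V | v ∈ cl η.toFinset u} → (ω ∈ EG' ↔ (ω \ ↑DX') ∈ E))) :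
    (rcMeasureW w q ∅).real EG = (rcMeasureW w' q ∅).real EG' := by
  have hZ := rcPartitionFunctionW_pos w hq (∅ : Set V)
  have hZ' := rcPartitionFunctionW_pos w' hq (∅ : Set V)
  have hK : q ^ clusterCount (∅ : BondConfig V) ({u, v} : Set V) ≠ 0 := (pow_pos hq _).ne'
  have eE := sum_eq (q := q) huv hsepD w wX wY hw hX hX' hY hY' hEJ hEn
  have eE' := sum_eq (q := q) huv hsepD' w' wX' wY hw' gX gX' gY gY' gEJ gEn
  have eU := sum_eq (q := q) huv hsepD w wX wY hw hX hX' hY hY' (EG := Set.univ) (E := Set.univ)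
    (fun _ _ _ => by simp only [Set.mem_univ]) (fun _ _ _ => by simp only [Set.mem_univ])
  have eU' := sum_eq (q := q) huv hsepD' w' wX' wY hw' gX gX' gY gY' (EG := Set.univ) (E := Set.univ)
    (fun _ _ _ => by simp only [Set.mem_univ]) (fun _ _ _ => by simp only [Set.mem_univ])
  have hZu : rcPartitionFunctionW w q ∅ = ∑ ω : BondConfig V, rcWeightW w q ∅ ω * ind Set.univ ω := by
    unfold rcPartitionFunctionW
    exact Finset.sum_congr rfl fun ω _ => by rw [ind_of_mem (Set.mem_univ _), mul_one]
  have hZu' : rcPartitionFunctionW w' q ∅ = ∑ ω : BondConfig V, rcWeightW w' q ∅ ω * ind Set.univ ω := by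
    unfold rcPartitionFunctionW
    exact Finset.sum_congr rfl fun ω _ => by rw [ind_of_mem (Set.mem_univ _), mul_one]
  rw [rcMeasureW_real_eq_sum_div w hq, rcMeasureW_real_eq_sum_div w' hq, div_eq_div_iff hZ.ne' hZ'.ne', hZu, hZu']
  refine mul_right_cancel₀ (mul_ne_zero hK hK) ?_
  set ZE := ∑ ω : BondConfig V, rcWeightW w q ∅ ω * ind EG ω
  set ZE' := ∑ ω : BondConfig V, rcWeightW w' q ∅ ω * ind EG' ω
  set ZU := ∑ ω : BondConfig V, rcWeightW w q ∅ ω * ind Set.univ ω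
  set ZU' := ∑ ω : BondConfig V, rcWeightW w' q ∅ ω * ind Set.univ ω
  set K := q ^ clusterCount (∅ : BondConfig V) ({u, v} : Set V)
  set X₁ := (∑ η : BondConfig V, rcWeightW wX q ({u, v} : Set V) η * ind {η : BondConfig V | v ∈ cl η.toFinset u} η)
  set X₀ := (∑ η : BondConfig V, rcWeightW wX q ({u, v} : Set V) η * ind {η : BondConfig V | v ∉ cl η.toFinset u} η)
  set X₁' := (∑ η : BondConfig V, rcWeightW wX' q ({u, v} : Set V) η * ind {η : BondConfig V | v ∈ cl η.toFinset u} η)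
  set X₀' := (∑ η : BondConfig V, rcWeightW wX' q ({u, v} : Set V) η * ind {η : BondConfig V | v ∉ cl η.toFinset u} η)
  set A := (∑ η : BondConfig V, rcWeightW wY q ({u, v} : Set V) η * ind {η : BondConfig V | insert s(u, v) η ∈ E} η)
  set B := (∑ η : BondConfig V, rcWeightW wY q ({u, v} : Set V) η * (ind E η * (if η ∈ {η : BondConfig V | v ∈ cl η.toFinset u} then 1 else q)))
  set AU := (∑ η : BondConfig V, rcWeightW wY q ({u, v} : Set V) η * ind {η : BondConfig V | insert s(u, v) η ∈ Set.univ} η)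
  set BU := (∑ η : BondConfig V, rcWeightW wY q ({u, v} : Set V) η * (ind Set.univ η * (if η ∈ {η : BondConfig V | v ∈ cl η.toFinset u} then 1 else q)))
  linear_combination (ZU' * K) * eE + (X₁ * A + X₀ * B) * eU' - (ZU * K) * eE' - (X₁' * A + X₀' * B) * eU +
    (A * BU - B * AU) * hodds

include ha hb hc ha' hb' hc'

/-- **Cell `T` is fold-invariant.** [this work] -/
theorem real_T_eq : (rcMeasureW w q ∅).real {η : BondConfig V | b ∈ cl η.toFinset a ∧ c ∈ cl η.toFinset a} = (rcMeasureW w' q ∅).real {η : BondConfig V | b ∈ cl η.toFinset a ∧ c ∈ cl η.toFinset a} := by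
  refine real_eq_of_replace huv hsepD hsepD' w w' wX wX' wY hq hw hw' hX hX' hY hY' gX gX' gY gY' hodds
    (E := {η : BondConfig V | b ∈ cl η.toFinset a ∧ c ∈ cl η.toFinset a}) ?_ ?_ ?_ ?_
  · intro ω hω hJ
    simp only [Set.mem_setOf_eq]
    rw [mem_cl_iff_of_J huv hsepD ha hb hω hJ, mem_cl_iff_of_J huv hsepD ha hc hω hJ]
    simp only [Set.mem_setOf_eq]
  · intro ω hω hJ
    simp only [Set.mem_setOf_eq]
    rw [mem_cl_iff_of_not_J huv hsepD ha hb hω hJ, mem_cl_iff_of_not_J huv hsepD ha hc hω hJ]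
    simp only [Set.mem_setOf_eq]
  · intro ω hω hJ
    simp only [Set.mem_setOf_eq]
    rw [mem_cl_iff_of_J huv hsepD' ha' hb' hω hJ, mem_cl_iff_of_J huv hsepD' ha' hc' hω hJ]
    simp only [Set.mem_setOf_eq]
  · intro ω hω hJ
    simp only [Set.mem_setOf_eq]
    rw [mem_cl_iff_of_not_J huv hsepD' ha' hb' hω hJ, mem_cl_iff_of_not_J huv hsepD' ha' hc' hω hJ]
    simp only [Set.mem_setOf_eq]

/-- **Cell `U_b` is fold-invariant.** [this work] -/
theorem real_Ub_eq : (rcMeasureW w q ∅).real {η : BondConfig V | b ∈ cl η.toFinset a ∧ c ∉ cl η.toFinset a} = (rcMeasureW w' q ∅).real {η : BondConfig V | b ∈ cl η.toFinset a ∧ c ∉ cl η.toFinset a} := by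
  refine real_eq_of_replace huv hsepD hsepD' w w' wX wX' wY hq hw hw' hX hX' hY hY' gX gX' gY gY' hodds
    (E := {η : BondConfig V | b ∈ cl η.toFinset a ∧ c ∉ cl η.toFinset a}) ?_ ?_ ?_ ?_
  · intro ω hω hJ
    simp only [Set.mem_setOf_eq]
    rw [mem_cl_iff_of_J huv hsepD ha hb hω hJ, mem_cl_iff_of_J huv hsepD ha hc hω hJ]
    simp only [Set.mem_setOf_eq]
  · intro ω hω hJ
    simp only [Set.mem_setOf_eq]
    rw [mem_cl_iff_of_not_J huv hsepD ha hb hω hJ, mem_cl_iff_of_not_J huv hsepD ha hc hω hJ]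
    simp only [Set.mem_setOf_eq]
  · intro ω hω hJ
    simp only [Set.mem_setOf_eq]
    rw [mem_cl_iff_of_J huv hsepD' ha' hb' hω hJ, mem_cl_iff_of_J huv hsepD' ha' hc' hω hJ]
    simp only [Set.mem_setOf_eq]
  · intro ω hω hJ
    simp only [Set.mem_setOf_eq]
    rw [mem_cl_iff_of_not_J huv hsepD' ha' hb' hω hJ, mem_cl_iff_of_not_J huv hsepD' ha' hc' hω hJ]
    simp only [Set.mem_setOf_eq]

/-- **Cell `U_c` is fold-invariant.** [this work] -/
theorem real_Uc_eq : (rcMeasureW w q ∅).real {η : BondConfig V | b ∉ cl η.toFinset a ∧ c ∈ cl η.toFinset a} = (rcMeasureW w' q ∅).real {η : BondConfig V | b ∉ cl η.toFinset a ∧ c ∈ cl η.toFinset a} := by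
  refine real_eq_of_replace huv hsepD hsepD' w w' wX wX' wY hq hw hw' hX hX' hY hY' gX gX' gY gY' hodds
    (E := {η : BondConfig V | b ∉ cl η.toFinset a ∧ c ∈ cl η.toFinset a}) ?_ ?_ ?_ ?_
  · intro ω hω hJ
    simp only [Set.mem_setOf_eq]
    rw [mem_cl_iff_of_J huv hsepD ha hb hω hJ, mem_cl_iff_of_J huv hsepD ha hc hω hJ]
    simp only [Set.mem_setOf_eq]
  · intro ω hω hJ
    simp only [Set.mem_setOf_eq]
    rw [mem_cl_iff_of_not_J huv hsepD ha hb hω hJ, mem_cl_iff_of_not_J huv hsepD ha hc hω hJ]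
    simp only [Set.mem_setOf_eq]
  · intro ω hω hJ
    simp only [Set.mem_setOf_eq]
    rw [mem_cl_iff_of_J huv hsepD' ha' hb' hω hJ, mem_cl_iff_of_J huv hsepD' ha' hc' hω hJ]
    simp only [Set.mem_setOf_eq]
  · intro ω hω hJ
    simp only [Set.mem_setOf_eq]
    rw [mem_cl_iff_of_not_J huv hsepD' ha' hb' hω hJ, mem_cl_iff_of_not_J huv hsepD' ha' hc' hω hJ]
    simp only [Set.mem_setOf_eq]

include hN hN' in
/-- **The separating cell is fold-invariant** (supports `DX ∪ DY` and `DX' ∪ DY`). [this work] -/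
theorem real_S_eq : (rcMeasureW w q ∅).real {η : BondConfig V | b ∉ cl η.toFinset a ∧ c ∉ cl η.toFinset a ∧ Sep (DX ∪ DY) (cl η.toFinset a) b c} = (rcMeasureW w' q ∅).real {η : BondConfig V | b ∉ cl η.toFinset a ∧ c ∉ cl η.toFinset a ∧ Sep (DX' ∪ DY) (cl η.toFinset a) b c} := by
  refine real_eq_of_replace huv hsepD hsepD' w w' wX wX' wY hq hw hw' hX hX' hY hY' gX gX' gY gY' hodds
    (E := {η : BondConfig V | b ∉ cl η.toFinset a ∧ c ∉ cl η.toFinset a ∧ Sep ({s(u, v)} ∪ DY) (cl η.toFinset a) b c}) ?_ ?_ ?_ ?_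
  · intro ω hω hJ
    simp only [Set.mem_setOf_eq]
    rw [mem_cl_iff_of_J huv hsepD ha hb hω hJ, mem_cl_iff_of_J huv hsepD ha hc hω hJ, sep_iff_of_J huv hsepD ha hb hc hN hω hJ]
    simp only [Set.mem_setOf_eq]
  · intro ω hω hJ
    simp only [Set.mem_setOf_eq]
    rw [mem_cl_iff_of_not_J huv hsepD ha hb hω hJ, mem_cl_iff_of_not_J huv hsepD ha hc hω hJ,
      sep_iff_of_not_J huv hsepD ha hb hc hN hω hJ]
    simp only [Set.mem_setOf_eq]
  · intro ω hω hJ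
    simp only [Set.mem_setOf_eq]
    rw [mem_cl_iff_of_J huv hsepD' ha' hb' hω hJ, mem_cl_iff_of_J huv hsepD' ha' hc' hω hJ,
      sep_iff_of_J huv hsepD' ha' hb' hc' hN' hω hJ]
    simp only [Set.mem_setOf_eq]
  · intro ω hω hJ
    simp only [Set.mem_setOf_eq]
    rw [mem_cl_iff_of_not_J huv hsepD' ha' hb' hω hJ, mem_cl_iff_of_not_J huv hsepD' ha' hc' hω hJ,
      sep_iff_of_not_J huv hsepD' ha' hb' hc' hN' hω hJ]
    simp only [Set.mem_setOf_eq]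

include hN hN' in
/-- **R1 is fold-invariant**: with supports `D = DX ∪ DY`, `D' = DX' ∪ DY` given by their membership predicates, R1 for `(a; b, c)` holds for
`φ_{𝐩,q}` iff it holds for `φ_{𝐩',q}`. [this work] -/
theorem r1_iff {D D' : Finset (Sym2 V)} (hD : ∀ e, e ∈ D ↔ e ∈ DX ∨ e ∈ DY) (hD' : ∀ e, e ∈ D' ↔ e ∈ DX' ∨ e ∈ DY) :
    ((rcMeasureW w q ∅).real {η : BondConfig V | b ∈ cl η.toFinset a ∧ c ∈ cl η.toFinset a} * (rcMeasureW w q ∅).real {η : BondConfig V | b ∉ cl η.toFinset a ∧ c ∉ cl η.toFinset a ∧ Sep D (cl η.toFinset a) b c} ≤ (rcMeasureW w q ∅).real {η : BondConfig V | b ∈ cl η.toFinset a ∧ c ∉ cl η.toFinset a} * (rcMeasureW w q ∅).real {η : BondConfig V | b ∉ cl η.toFinset a ∧ c ∈ cl η.toFinset a}) ↔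
      ((rcMeasureW w' q ∅).real {η : BondConfig V | b ∈ cl η.toFinset a ∧ c ∈ cl η.toFinset a} * (rcMeasureW w' q ∅).real {η : BondConfig V | b ∉ cl η.toFinset a ∧ c ∉ cl η.toFinset a ∧ Sep D' (cl η.toFinset a) b c} ≤ (rcMeasureW w' q ∅).real {η : BondConfig V | b ∈ cl η.toFinset a ∧ c ∉ cl η.toFinset a} * (rcMeasureW w' q ∅).real {η : BondConfig V | b ∉ cl η.toFinset a ∧ c ∈ cl η.toFinset a}) := by
  have hDD : D = DX ∪ DY := by ext e; rw [Finset.mem_union]; exact hD e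
  have hDD' : D' = DX' ∪ DY := by ext e; rw [Finset.mem_union]; exact hD' e
  subst hDD hDD'
  rw [real_T_eq huv hsepD hsepD' ha ha' hb hb' hc hc' w w' wX wX' wY hq hw hw' hX hX' hY hY' gX gX' gY gY' hodds,
    real_Ub_eq huv hsepD hsepD' ha ha' hb hb' hc hc' w w' wX wX' wY hq hw hw' hX hX' hY hY' gX gX' gY gY' hodds,
    real_Uc_eq huv hsepD hsepD' ha ha' hb hb' hc hc' w w' wX wX' wY hq hw hw' hX hX' hY hY' gX gX' gY gY' hodds,
    real_S_eq huv hsepD hsepD' ha ha' hb hb' hc hc' hN hN' w w' wX wX' wY hq hw hw' hX hX' hY hY' gX gX' gY gY' hodds]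

end Main

end NetworkFold

end Summit.CriticalPhenomena.PercolationContinuityZ3.Theorems
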